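import Summits.BirchSwinnertonDyer.BirchSwinnertonDyer.Theorems.AdditiveKolyvaginRoadLevelKolyvaginSystemsAdditiveOfKolyvaginPrimitiveOfTwin
import Summits.BirchSwinnertonDyer.BirchSwinnertonDyer.Theorems.AdditiveKolyvaginRoadLevelKolyvaginSystemsAdditiveTwinRise
import Summits.BirchSwinnertonDyer.BirchSwinnertonDyer.Theorems.AdditiveKolyvaginRoadLevelKolyvaginSystemsAdditiveTwinJump
import HarnessLib

/-!
# Route `AdditiveKolyvaginRoad`, crux KS′ `LevelKolyvaginSystemsAdditive` (item stmt-BirchSwinnertonDyer-21396):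
# KS′'s fibre from ONE SEED modulo the LOCAL TRICHOTOMY at Kolyvagin primes — (Twin) assembled from `…TwinDrop` ∕ `…TwinRise` ∕ `…TwinJump`;
# route level KS′ ⟸ KPA′ + PUB + DUAL + TRICH; KS′ on the good-avatar locus of line `epsilon_matched_retyping`, datum-free, modulo TRICH
# (cell `pub/bsd-wall`, width seat `bsd-wall-akr-p2x-w2` g6; `--supports stmt-BirchSwinnertonDyer-21396`, helper; skeleton v10's on-locus branch)

WHY. `nonempty_levelKolyvaginSystemP_of_seed_of_twin` (p625738) reduced KS′'s fibre at a frame to ONE seed + Poitou–Tate + odd bottom rank + the TWIN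
DICHOTOMY (`hDrop` ∧ `hRise` ∧ `hJump`, Howard 2004 Lemma 2.5.3) for the mixed Selmer spaces. `twinDrop_mixed` (p628205) and `twinRise_mixed` (p629499)
are tree theorems; `twinJump_mixed_of_trich` (p628901) gives `hJump` from the detected signed supply (Poitou–Tate) and the LOCAL TRICHOTOMY (TRICH): «a
`μ`-eigenclass of the `λ`-relaxed mixed structure not Kummer at `λ` is transverse at `λ`». THIS FILE assembles:
* §1 `twin_mixed_of_trich` — (Twin) ⟸ TRICH (+ frame: `K` imaginary quadratic with `d_K < −4`, `p` odd, `ρ̄` onto, `c ≠ 1`, Poitou–Tate).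
* §2 `nonempty_levelKolyvaginSystemP_of_seed_of_trich` (KS′-fibre ⟸ seed ∧ PT ∧ odd bottom rank ∧ TRICH), `levelKolyvaginSystemsAdditive_of_kolyvaginPrimitive_of_trich`
  (ROUTE LEVEL: `PUB → DUAL → TRICH → KolyvaginPrimitiveAdditive → LevelKolyvaginSystemsAdditive`), `levelKolyvaginSystemsAdditive_onGoodAvatarLocus_of_trich`
  (the good-avatar locus WITHOUT the displayed Zhang datum: Kriz–Li seed + PUB + DUAL + TRICH).

TRICH is FRAME-UNIFORM (no avatar, no locus, any reduction type at `p`) and in print (Gross 1991 Prop. 8.1–8.2; Howard 2004 Lemma 2.5.3): the symmetric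
Frobenius lift `F` of `exists_frobeniusLift_of_isKolyvaginPrime` has `F|_{ℚ̄} = h²` with `h` a lift of complex conjugation, so `F` FIXES `K[ℓ]` (every element
of the non-trivial coset of the generalized dihedral `Gal(K[ℓ]/ℚ)` is an involution); `h1Eval_frob_eq_zero_of_cupProduct_self_eq_zero_P` gives `[x, F] = 0`
for an isotropic ramified eigenclass; the transverse condition is `{φ(F) = 0}` on such classes (`D_𝔓 = F^ℕ · I_𝔓 · U`, tree
`exists_eq_frobenius_pow_mul_of_mem_decompositionSubgroup`; inertia values on the `(−μ)`-line; tame inertia mod `p` cyclic).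

HONEST FRAMING: theorems only; 0 definitions, 0 named facts, 0 `sorry`; CONDITIONAL on TRICH (hypothesis) and on Poitou–Tate ∕ PUB ∕ DUAL ∕ Kriz–Li ∕
KPA′ BY NAME where stated. Closes nothing. BSD is not proved by any of this; KS′, KPA′ OPEN.

References: [cite: Howard2004HeegnerKolyvagin, Lemma 2.5.3] [cite: WZhang2014, Lemma 8.2, Lemma 8.4, §9] [cite: GrossLMS1991, Prop. 8.1, Prop. 8.2]
[cite: KrizLi2019, Thm. 1.16] [cite: McCallumLMS1991, Cor. 3.2, Lemma 5.3].
-/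

set_option linter.dupNamespace false -- single-conjunct summit repeats the name by design

noncomputable section

open scoped Classical

namespace Summit.BirchSwinnertonDyer.BirchSwinnertonDyer.Theorems.AdditiveKoly

open WeierstrassCurve NumberField IsDedekindDomain Field
  Literature.NumberTheory.EllipticCurves Literature.NumberTheory.EllipticCurves.ModularForms
  Literature.NumberTheory.EllipticCurves.Rank1Residual Literature.NumberTheory.GaloisRepresentations Module
  Literature.NumberTheory.GaloisCohomology
  Summit.BirchSwinnertonDyer.Rank1Residual.X11b.Three.Koly
  Summit.BirchSwinnertonDyer.BirchSwinnertonDyer.Theses.AdditiveKolyvaginRoad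
  Summit.BirchSwinnertonDyer.Rank1Residual

variable (W : WeierstrassCurve ℚ) (K : Type) [Field K] [NumberField K] (p : ℕ) [W.IsElliptic] [W.IsGloballyMinimal]
  [Fact p.Prime] (c : K ≃ₐ[ℚ] K) (ι : K →+* ℂ) [Module (ZMod p) (Vp W K p)]

/-! ## §1 (Twin) for the mixed spaces from the local trichotomy -/

/-- **(Twin) for the mixed Selmer spaces ⟸ the LOCAL TRICHOTOMY at Kolyvagin primes.** Frame: `K` imaginary quadratic with `d_K < −4`, `p` odd,
`ρ̄_{E,p}` onto, `c ≠ 1`, Poitou–Tate for Selmer structures over `K`; `Mix` the mixed spaces (membership dictionary, finite). GIVEN the local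
trichotomy TRICH («a `μ`-eigenclass of the `λ`-relaxed mixed structure not Kummer at `λ` is transverse at `λ`»), the three binders of Howard 2004
Lemma 2.5.3 hold: `hDrop` (`twinDrop_mixed`, PT-free), `hRise` (`twinRise_mixed`), `hJump` (`twinJump_mixed_of_trich`, from the detected signed supply).
[cite: Howard2004HeegnerKolyvagin, Lemma 2.5.3] [cite: WZhang2014, Lemma 8.2, Lemma 8.4] [cite: GrossLMS1991, Prop. 8.1, Prop. 8.2] -/
theorem twin_mixed_of_trich [NeZero (W.conductorNorm ℤ)] (hK : IsImaginaryQuadratic K) (hp2 : p ≠ 2) (hd : NumberField.discr K < -4)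
    (hsurj : W.HasSurjectiveModNGaloisRep p) (hc : c ≠ 1) (hPT : poitouTate_selmerStructure_duality K)
    (htrich : (∀ (m : Finset {ℓ // Zhang2014.IsKolyvaginPrime (W.conductorNorm ℤ) W K p ℓ}) (ℓ : {ℓ // Zhang2014.IsKolyvaginPrime (W.conductorNorm ℤ) W K p ℓ}) (n : Finset (AdmQ W K p)) (v : HeightOneSpectrum (𝓞 K)) (μ : Bool)
      (x : Vp W K p), ℓ ∉ m → ((ℓ : ℕ) : 𝓞 K) ∈ v.asIdeal → conjAct W c ((p ^ 1 : ℕ) : ℤ) x = sgnP μ • x →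
      ((∀ w : InfinitePlace K, x ∈ selmerLocalKer (W.baseChange K) w.Completion ((p ^ 1 : ℕ) : ℤ)) ∧
      (∀ w : HeightOneSpectrum (𝓞 K), ((ℓ : ℕ) : 𝓞 K) ∉ w.asIdeal → (∀ ℓ' ∈ m, ((ℓ' : ℕ) : 𝓞 K) ∉ w.asIdeal) →
        (∀ q ∈ n, ((q : ℕ) : 𝓞 K) ∉ w.asIdeal) → x ∈ selmerLocalKer (W.baseChange K) (w.adicCompletion K) ((p ^ 1 : ℕ) : ℤ)) ∧
      (∀ q ∈ n, ∀ w : HeightOneSpectrum (𝓞 K), ((q : ℕ) : 𝓞 K) ∈ w.asIdeal →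
        x ∈ toricLocalKer (W.baseChange K) (w.adicCompletion K) ((p ^ 1 : ℕ) : ℤ)) ∧
      (∀ ℓ' ∈ m, ∀ w : HeightOneSpectrum (𝓞 K), ((ℓ' : ℕ) : 𝓞 K) ∈ w.asIdeal → x ∈ transverseLocalKerP W K p ι ℓ' w)) →
      x ∉ selmerLocalKer (W.baseChange K) (v.adicCompletion K) ((p ^ 1 : ℕ) : ℤ) → x ∈ transverseLocalKerP W K p ι ℓ v))
    (Mix : Finset {ℓ // Zhang2014.IsKolyvaginPrime (W.conductorNorm ℤ) W K p ℓ} → Finset (AdmQ W K p) → Bool → Submodule (ZMod p) (Vp W K p))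
    (hMix : ∀ (m : Finset {ℓ // Zhang2014.IsKolyvaginPrime (W.conductorNorm ℤ) W K p ℓ}) (n : Finset (AdmQ W K p)) (μ : Bool) (x : Vp W K p),
      x ∈ Mix m n μ ↔ (conjAct W c ((p ^ 1 : ℕ) : ℤ) x = sgnP μ • x ∧
        (∀ w : InfinitePlace K, x ∈ selmerLocalKer (W.baseChange K) w.Completion ((p ^ 1 : ℕ) : ℤ)) ∧
        (∀ v : HeightOneSpectrum (𝓞 K), (∀ ℓ ∈ m, ((ℓ : ℕ) : 𝓞 K) ∉ v.asIdeal) → (∀ q ∈ n, ((q : ℕ) : 𝓞 K) ∉ v.asIdeal) →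
          x ∈ selmerLocalKer (W.baseChange K) (v.adicCompletion K) ((p ^ 1 : ℕ) : ℤ)) ∧
        (∀ q ∈ n, ∀ v : HeightOneSpectrum (𝓞 K), ((q : ℕ) : 𝓞 K) ∈ v.asIdeal →
          x ∈ toricLocalKer (W.baseChange K) (v.adicCompletion K) ((p ^ 1 : ℕ) : ℤ)) ∧
        (∀ ℓ ∈ m, ∀ v : HeightOneSpectrum (𝓞 K), ((ℓ : ℕ) : 𝓞 K) ∈ v.asIdeal → x ∈ transverseLocalKerP W K p ι ℓ v)))
    (hfin : ∀ (m : Finset {ℓ // Zhang2014.IsKolyvaginPrime (W.conductorNorm ℤ) W K p ℓ}) (n : Finset (AdmQ W K p)) (μ : Bool), Module.Finite (ZMod p) (Mix m n μ)) :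
    (∀ (m : Finset {ℓ // Zhang2014.IsKolyvaginPrime (W.conductorNorm ℤ) W K p ℓ}) (ℓ : {ℓ // Zhang2014.IsKolyvaginPrime (W.conductorNorm ℤ) W K p ℓ}) (n : Finset (AdmQ W K p)) (μ : Bool), ℓ ∉ m → n.Nonempty →
        (∃ x ∈ Mix m n μ, ¬ (∀ v : HeightOneSpectrum (𝓞 K), ((ℓ : ℕ) : 𝓞 K) ∈ v.asIdeal → x ∈ (W.baseChange K).torsionLocalKer (v.adicCompletion K) ((p ^ 1 : ℕ) : ℤ))) →
        (∀ y, y ∈ Mix (insert ℓ m) n μ ↔ (y ∈ Mix m n μ ∧ (∀ v : HeightOneSpectrum (𝓞 K), ((ℓ : ℕ) : 𝓞 K) ∈ v.asIdeal → y ∈ (W.baseChange K).torsionLocalKer (v.adicCompletion K) ((p ^ 1 : ℕ) : ℤ)))) ∧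
          finrank (ZMod p) (Mix (insert ℓ m) n μ) + 1 = finrank (ZMod p) (Mix m n μ)) ∧
      (∀ (m : Finset {ℓ // Zhang2014.IsKolyvaginPrime (W.conductorNorm ℤ) W K p ℓ}) (ℓ : {ℓ // Zhang2014.IsKolyvaginPrime (W.conductorNorm ℤ) W K p ℓ}) (n : Finset (AdmQ W K p)) (μ : Bool), ℓ ∉ m → n.Nonempty →
        (∃ y ∈ Mix (insert ℓ m) n μ, ¬ (∀ v : HeightOneSpectrum (𝓞 K), ((ℓ : ℕ) : 𝓞 K) ∈ v.asIdeal → y ∈ (W.baseChange K).torsionLocalKer (v.adicCompletion K) ((p ^ 1 : ℕ) : ℤ))) →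
        (∀ x, x ∈ Mix m n μ ↔ (x ∈ Mix (insert ℓ m) n μ ∧ (∀ v : HeightOneSpectrum (𝓞 K), ((ℓ : ℕ) : 𝓞 K) ∈ v.asIdeal → x ∈ (W.baseChange K).torsionLocalKer (v.adicCompletion K) ((p ^ 1 : ℕ) : ℤ)))) ∧
          finrank (ZMod p) (Mix m n μ) + 1 = finrank (ZMod p) (Mix (insert ℓ m) n μ)) ∧
      (∀ (m : Finset {ℓ // Zhang2014.IsKolyvaginPrime (W.conductorNorm ℤ) W K p ℓ}) (ℓ : {ℓ // Zhang2014.IsKolyvaginPrime (W.conductorNorm ℤ) W K p ℓ}) (n : Finset (AdmQ W K p)) (μ : Bool), ℓ ∉ m → n.Nonempty →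
        (∃ x ∈ Mix m n μ, ¬ (∀ v : HeightOneSpectrum (𝓞 K), ((ℓ : ℕ) : 𝓞 K) ∈ v.asIdeal → x ∈ (W.baseChange K).torsionLocalKer (v.adicCompletion K) ((p ^ 1 : ℕ) : ℤ))) ∨ (∃ y ∈ Mix (insert ℓ m) n μ, ¬ (∀ v : HeightOneSpectrum (𝓞 K), ((ℓ : ℕ) : 𝓞 K) ∈ v.asIdeal → y ∈ (W.baseChange K).torsionLocalKer (v.adicCompletion K) ((p ^ 1 : ℕ) : ℤ)))) := by
  have hp : p.Prime := Fact.out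
  letI : ∀ v : Place K, Module (ZMod p)
      (galoisCohomology (((W.baseChange K).torsionGaloisModule ((p ^ 1 : ℕ) : ℤ)).toLocal v) 1) := fun v ↦
    AddCommGroup.zmodModule (fun x ↦ by
      have h := galoisCohomology.nsmul_eq_zero_of_forall
        (((W.baseChange K).torsionGaloisModule ((p ^ 1 : ℕ) : ℤ)).toLocal v) (n := p ^ 1)
        (fun m => AddSubgroup.torsionBy.nsmul m) x
      simpa using h)
  exact ⟨twinDrop_mixed W K p c ι hK hp2 hsurj hc Mix hMix hfin, twinRise_mixed W K p c ι hK hp2 hsurj hc Mix hMix hfin,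
    twinJump_mixed_of_trich W K p c ι hK hp2 hd hsurj hc hPT htrich Mix hMix⟩

/-! ## §2 KS′'s fibre from ONE seed and the local trichotomy; route level; the good-avatar locus -/

/-- **THE FIBRE OF KS′ AT A FRAME FROM ONE SEED, modulo the LOCAL TRICHOTOMY** (`nonempty_levelKolyvaginSystemP_of_seed_of_twin` with (Twin)
discharged by `twin_mixed_of_trich` and the mixed spaces by `exists_mixedSpaces`): at a frame (`E` globally minimal, `p ≥ 5`, `ρ̄` onto — any reduction
type —, `K` imaginary quadratic Heegner for `N_E` with `d_K < −4`, `4N ∣ β² − d_K`, `c ≠ 1`), Poitou–Tate ∧ odd bottom rank ∧ TRICH ∧ ONE SEED ⟹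
`Nonempty (LevelKolyvaginSystemP W K p Dt β ι c)`. [cite: Howard2004HeegnerKolyvagin, Lemma 2.5.3] [cite: WZhang2014, §9] -/
theorem nonempty_levelKolyvaginSystemP_of_seed_of_trich [NeZero (W.conductorNorm ℤ)]
    (Dt : ModularParametrizationData W (W.conductorNorm ℤ)) (β : ℤ)
    (hK : IsImaginaryQuadratic K) (hp5 : 5 ≤ p) (hlt : NumberField.discr K < -4) (hsurj : W.HasSurjectiveModNGaloisRep p) (hc1 : c ≠ 1)
    (hH : SatisfiesHeegnerHypothesis (W.conductorNorm ℤ) K) (hβ : (4 * (W.conductorNorm ℤ : ℤ)) ∣ β ^ 2 - NumberField.discr K)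
    (hPT : poitouTate_selmerStructure_duality K)
    (hodd : Odd (finrank (ZMod p) (SelQP W K p c ∅ true) + finrank (ZMod p) (SelQP W K p c ∅ false)))
    (htrich : (∀ (m : Finset {ℓ // Zhang2014.IsKolyvaginPrime (W.conductorNorm ℤ) W K p ℓ}) (ℓ : {ℓ // Zhang2014.IsKolyvaginPrime (W.conductorNorm ℤ) W K p ℓ}) (n : Finset (AdmQ W K p)) (v : HeightOneSpectrum (𝓞 K)) (μ : Bool)
      (x : Vp W K p), ℓ ∉ m → ((ℓ : ℕ) : 𝓞 K) ∈ v.asIdeal → conjAct W c ((p ^ 1 : ℕ) : ℤ) x = sgnP μ • x →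
      ((∀ w : InfinitePlace K, x ∈ selmerLocalKer (W.baseChange K) w.Completion ((p ^ 1 : ℕ) : ℤ)) ∧
      (∀ w : HeightOneSpectrum (𝓞 K), ((ℓ : ℕ) : 𝓞 K) ∉ w.asIdeal → (∀ ℓ' ∈ m, ((ℓ' : ℕ) : 𝓞 K) ∉ w.asIdeal) →
        (∀ q ∈ n, ((q : ℕ) : 𝓞 K) ∉ w.asIdeal) → x ∈ selmerLocalKer (W.baseChange K) (w.adicCompletion K) ((p ^ 1 : ℕ) : ℤ)) ∧
      (∀ q ∈ n, ∀ w : HeightOneSpectrum (𝓞 K), ((q : ℕ) : 𝓞 K) ∈ w.asIdeal →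
        x ∈ toricLocalKer (W.baseChange K) (w.adicCompletion K) ((p ^ 1 : ℕ) : ℤ)) ∧
      (∀ ℓ' ∈ m, ∀ w : HeightOneSpectrum (𝓞 K), ((ℓ' : ℕ) : 𝓞 K) ∈ w.asIdeal → x ∈ transverseLocalKerP W K p ι ℓ' w)) →
      x ∉ selmerLocalKer (W.baseChange K) (v.adicCompletion K) ((p ^ 1 : ℕ) : ℤ) → x ∈ transverseLocalKerP W K p ι ℓ v))
    (seed : ∃ (m : Finset {ℓ // Zhang2014.IsKolyvaginPrime (W.conductorNorm ℤ) W K p ℓ}) (d : KolyvaginHeegnerData Dt β ι (∏ ℓ ∈ m, (ℓ : ℕ))),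
      d.kolyvaginClass (Fact.out : p.Prime) 1 ≠ 0) :
    Nonempty (LevelKolyvaginSystemP W K p Dt β ι c) := by
  have hp2 : p ≠ 2 := by omega
  obtain ⟨Mix, hMix, hfin⟩ := exists_mixedSpaces W K p c ι
  obtain ⟨hDrop, hRise, hJump⟩ := twin_mixed_of_trich W K p c ι hK hp2 hlt hsurj hc1 hPT htrich Mix hMix hfin
  exact nonempty_levelKolyvaginSystemP_of_seed_of_twin W K p c ι Dt β hK hp5 hsurj hc1 hH hβ hPT hodd Mix hMix hfin hDrop hRise hJump seed

/-- **ROUTE LEVEL: KS′ ⟸ KPA′ + PUB + DUAL + TRICH** — `levelKolyvaginSystemsAdditive_of_kolyvaginPrimitive_of_twin` with (Twin) replaced by the local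
trichotomy at every ♯-type frame. [cite: Howard2004HeegnerKolyvagin, Lemma 2.5.3] [cite: WZhang2014, §9] -/
theorem levelKolyvaginSystemsAdditive_of_kolyvaginPrimitive_of_trich (hPUB : PublishedInputsAdditiveKoly)
    (hDual : PublishedDualityInputsAdditiveKoly)
    (hTrich : (∀ (W : WeierstrassCurve ℚ) [W.IsElliptic] [W.IsGloballyMinimal] [NeZero (W.conductorNorm ℤ)] (p : ℕ) [Fact p.Prime]
      (K : Type) [Field K] [NumberField K] (c : K ≃ₐ[ℚ] K) (ι : K →+* ℂ),
      5 ≤ p → W.HasSurjectiveModNGaloisRep p → IsImaginaryQuadratic K → NumberField.discr K < -4 → c ≠ 1 →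
      ∀ [Module (ZMod p) (Vp W K p)],
      (∀ (m : Finset {ℓ // Zhang2014.IsKolyvaginPrime (W.conductorNorm ℤ) W K p ℓ}) (ℓ : {ℓ // Zhang2014.IsKolyvaginPrime (W.conductorNorm ℤ) W K p ℓ}) (n : Finset (AdmQ W K p)) (v : HeightOneSpectrum (𝓞 K)) (μ : Bool)
      (x : Vp W K p), ℓ ∉ m → ((ℓ : ℕ) : 𝓞 K) ∈ v.asIdeal → conjAct W c ((p ^ 1 : ℕ) : ℤ) x = sgnP μ • x →
      ((∀ w : InfinitePlace K, x ∈ selmerLocalKer (W.baseChange K) w.Completion ((p ^ 1 : ℕ) : ℤ)) ∧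
      (∀ w : HeightOneSpectrum (𝓞 K), ((ℓ : ℕ) : 𝓞 K) ∉ w.asIdeal → (∀ ℓ' ∈ m, ((ℓ' : ℕ) : 𝓞 K) ∉ w.asIdeal) →
        (∀ q ∈ n, ((q : ℕ) : 𝓞 K) ∉ w.asIdeal) → x ∈ selmerLocalKer (W.baseChange K) (w.adicCompletion K) ((p ^ 1 : ℕ) : ℤ)) ∧
      (∀ q ∈ n, ∀ w : HeightOneSpectrum (𝓞 K), ((q : ℕ) : 𝓞 K) ∈ w.asIdeal →
        x ∈ toricLocalKer (W.baseChange K) (w.adicCompletion K) ((p ^ 1 : ℕ) : ℤ)) ∧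
      (∀ ℓ' ∈ m, ∀ w : HeightOneSpectrum (𝓞 K), ((ℓ' : ℕ) : 𝓞 K) ∈ w.asIdeal → x ∈ transverseLocalKerP W K p ι ℓ' w)) →
      x ∉ selmerLocalKer (W.baseChange K) (v.adicCompletion K) ((p ^ 1 : ℕ) : ℤ) → x ∈ transverseLocalKerP W K p ι ℓ v)))
    (hKPA : KolyvaginPrimitiveAdditive) : LevelKolyvaginSystemsAdditive := by
  refine levelKolyvaginSystemsAdditive_of_kolyvaginPrimitive_of_twin hPUB hDual ?_ hKPA
  intro W _ _ _ p _ K _ _ c ι hp5 hs hK hlt hc1 hPT _ Mix hMix hfin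
  exact twin_mixed_of_trich W K p c ι hK (by omega) hlt hs hc1 hPT (hTrich W p K c ι hp5 hs hK hlt hc1) Mix hMix hfin

/-- **KS′ ON THE GOOD-AVATAR LOCUS, DATUM-FREE, modulo the local trichotomy** — `levelKolyvaginSystemsAdditive_onGoodAvatarLocus_of_twin` with (Twin)
replaced by TRICH. This is the on-locus branch of skeleton v10 of line `epsilon_matched_retyping`. [cite: KrizLi2019, Thm. 1.16]
[cite: Howard2004HeegnerKolyvagin, Lemma 2.5.3] -/
theorem levelKolyvaginSystemsAdditive_onGoodAvatarLocus_of_trich (hKL : KrizLi2019.thm116_padicLogHeegner_congruence)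
    (hPUB : PublishedInputsAdditiveKoly) (hDual : PublishedDualityInputsAdditiveKoly)
    (hTrich : (∀ (W : WeierstrassCurve ℚ) [W.IsElliptic] [W.IsGloballyMinimal] [NeZero (W.conductorNorm ℤ)] (p : ℕ) [Fact p.Prime]
      (K : Type) [Field K] [NumberField K] (c : K ≃ₐ[ℚ] K) (ι : K →+* ℂ),
      5 ≤ p → W.HasSurjectiveModNGaloisRep p → IsImaginaryQuadratic K → NumberField.discr K < -4 → c ≠ 1 →
      ∀ [Module (ZMod p) (Vp W K p)],
      (∀ (m : Finset {ℓ // Zhang2014.IsKolyvaginPrime (W.conductorNorm ℤ) W K p ℓ}) (ℓ : {ℓ // Zhang2014.IsKolyvaginPrime (W.conductorNorm ℤ) W K p ℓ}) (n : Finset (AdmQ W K p)) (v : HeightOneSpectrum (𝓞 K)) (μ : Bool)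
      (x : Vp W K p), ℓ ∉ m → ((ℓ : ℕ) : 𝓞 K) ∈ v.asIdeal → conjAct W c ((p ^ 1 : ℕ) : ℤ) x = sgnP μ • x →
      ((∀ w : InfinitePlace K, x ∈ selmerLocalKer (W.baseChange K) w.Completion ((p ^ 1 : ℕ) : ℤ)) ∧
      (∀ w : HeightOneSpectrum (𝓞 K), ((ℓ : ℕ) : 𝓞 K) ∉ w.asIdeal → (∀ ℓ' ∈ m, ((ℓ' : ℕ) : 𝓞 K) ∉ w.asIdeal) →
        (∀ q ∈ n, ((q : ℕ) : 𝓞 K) ∉ w.asIdeal) → x ∈ selmerLocalKer (W.baseChange K) (w.adicCompletion K) ((p ^ 1 : ℕ) : ℤ)) ∧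
      (∀ q ∈ n, ∀ w : HeightOneSpectrum (𝓞 K), ((q : ℕ) : 𝓞 K) ∈ w.asIdeal →
        x ∈ toricLocalKer (W.baseChange K) (w.adicCompletion K) ((p ^ 1 : ℕ) : ℤ)) ∧
      (∀ ℓ' ∈ m, ∀ w : HeightOneSpectrum (𝓞 K), ((ℓ' : ℕ) : 𝓞 K) ∈ w.asIdeal → x ∈ transverseLocalKerP W K p ι ℓ' w)) →
      x ∉ selmerLocalKer (W.baseChange K) (v.adicCompletion K) ((p ^ 1 : ℕ) : ℤ) → x ∈ transverseLocalKerP W K p ι ℓ v)))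
    (W : WeierstrassCurve ℚ) [W.IsElliptic] [W.IsGloballyMinimal] [NeZero (W.conductorNorm ℤ)]
    (p : ℕ) [Fact p.Prime] (K : Type) [Field K] [NumberField K]
    (Dt : ModularParametrizationData W (W.conductorNorm ℤ)) (β : ℤ) (ι : K →+* ℂ)
    (hp : 5 ≤ p) (hadd : Addv W p) (hs : W.HasSurjectiveModNGaloisRep p)
    (hsp : ∀ (ℓ : ℕ) [Fact ℓ.Prime], W.HasMultiplicativeReductionAtPrime ℓ → ¬ p ∣ padicValInt ℓ W.minimalDiscriminantInt)
    (htwo : ∃ (ℓ₁ ℓ₂ : ℕ) (_ : Fact ℓ₁.Prime) (_ : Fact ℓ₂.Prime), ℓ₁ ≠ ℓ₂ ∧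
      W.HasMultiplicativeReductionAtPrime ℓ₁ ∧ W.HasMultiplicativeReductionAtPrime ℓ₂)
    (htam : ¬ p ∣ W.tamagawaProduct) (hr : W.analyticRank = 1) (hK : IsImaginaryQuadratic K) (hodd : Odd (NumberField.discr K))
    (hlt : NumberField.discr K < -4) (hH : SatisfiesHeegnerHypothesis (W.conductorNorm ℤ) K)
    (hL : (W.quadraticTwist (NumberField.discr K : ℚ)).entireLFunction 1 ≠ 0)
    (hβ : (4 * (W.conductorNorm ℤ : ℤ)) ∣ β ^ 2 - NumberField.discr K) (hc : ¬ (p : ℤ) ∣ Dt.c)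
    (hav : ∃ (W₀ : WeierstrassCurve ℚ) (_ : W₀.IsElliptic) (_ : W₀.IsGloballyMinimal) (_ : NeZero (W₀.conductorNorm ℤ))
      (Dt₀ : ModularParametrizationData W₀ (W₀.conductorNorm ℤ)) (e : geomTorsion W (p : ℤ) ≃+ geomTorsion W₀ (p : ℤ)),
      (∀ (σ : absoluteGaloisGroup ℚ) (P : geomTorsion W (p : ℤ)), e (σ • P) = σ • e P) ∧
      W₀.HasGoodReductionAtPrime p ∧ ¬ (p : ℤ) ∣ W₀.frobeniusTrace p - 1 ∧
      (∀ (ℓ : ℕ) [Fact ℓ.Prime], W₀.HasMultiplicativeReductionAtPrime ℓ →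
        ¬ p ∣ padicValInt ℓ W₀.minimalDiscriminantInt) ∧
      (∀ q : ℕ, q.Prime → (q ∣ p * W.conductorNorm ℤ ↔ q ∣ p * W₀.conductorNorm ℤ)) ∧
      (∀ (ℓ : ℕ) [Fact ℓ.Prime], W.HasMultiplicativeReductionAtPrime ℓ ↔ W₀.HasMultiplicativeReductionAtPrime ℓ) ∧
      SatisfiesHeegnerHypothesis (W₀.conductorNorm ℤ) K ∧ ¬ (p : ℤ) ∣ Dt₀.c ∧
      ∃ (ιp : K →+* ℚ_[p]) (H₀ : HeegnerDatum (W₀.conductorNorm ℤ) (NumberField.discr K))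
        (y₀ : (W₀.baseChange K).toAffine.Point),
        WeierstrassCurve.Affine.Point.map ι.toRatAlgHom y₀ = heegnerPointComplex Dt₀ H₀ ∧
          ¬ ∃ Q : (W₀.baseChange ℚ_[p]).toAffine.Point, (p : ℤ) • Q = X11b.padicPointOf W₀ p ιp y₀) :
    ∀ (c : K ≃ₐ[ℚ] K), c ≠ 1 → ∀ [Module (ZMod p) (Vp W K p)], Nonempty (LevelKolyvaginSystemP W K p Dt β ι c) := by
  refine levelKolyvaginSystemsAdditive_onGoodAvatarLocus_of_twin hKL hPUB hDual ?_ W p K Dt β ι hp hadd hs hsp htwo htam hr hK hodd hlt hH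
    hL hβ hc hav
  intro W _ _ _ p _ K _ _ c ι hp5 hs hK hlt hc1 hPT _ Mix hMix hfin
  exact twin_mixed_of_trich W K p c ι hK (by omega) hlt hs hc1 hPT (hTrich W p K c ι hp5 hs hK hlt hc1) Mix hMix hfin

end Summit.BirchSwinnertonDyer.BirchSwinnertonDyer.Theorems.AdditiveKoly

end
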